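import Mathlib
import Summits.MatrixMultiplication.MatrixMultiplication.Theorems.HiddenToeplitzCornersHiddenCornerLemmaRRankOnePencil
import Summits.MatrixMultiplication.MatrixMultiplication.Theorems.HiddenToeplitzCornersHiddenCornerLemmaRRankTwoSpacesAux

/-!
# Linear spaces of matrices of rank at most two are cheap compression classes

Support file for crux item `stmt-MatrixMultiplication-10752`
(`Summit.MatrixMultiplication.MatrixMultiplication.Theses.HiddenToeplitzCorners.HiddenCornerLemmaR`),
line `frobenius-dual-short-syzygies`, stub `stub_compressionReduction` (the `d ≤ 2` instance of the
Atkinson–Lloyd reduction).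

Main result `hclR_rank_le_two_pencil_split`: if `D : ι → Matrix m n ℂ` is a family all of whose linear
combinations have rank `≤ d` with `d ≤ 2`, then there are CONSTANT matrices `G₀ : m × p`, `H₀ : n × q`
with `2p + q ≤ 2d` and families `H₁ i : n × p`, `G₁ i : m × q` such that
`D i = G₀ (H₁ i)ᵀ + (G₁ i) H₀ᵀ` for every `i` (a "`(p,q)`-compression class" with the weights of the
hidden-corner lemma: a constant left generator costs two, a constant right generator one).

Proof (elementary, no structure theory of primitive spaces is needed for the WEIGHTED count):
* `d ≤ 1`: the landed dichotomy `hclR_rank_le_one_pencil_dichotomy` gives class `(1,0)` or `(0,1)`.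
* `d = 2` with an element `A` of rank `2` in the span: fix a frame `U Ψ = 1` on `im A`, `A Y = U`,
  `U Ψ A = A`, and the projection `Π = 1 − Y Ψ A` onto `ker A`.  Two polynomial identities in the
  pencil parameter (the `t`- and `t²`-coefficients of a `3 × 3` minor of `A + tB`, extracted from the
  values `t = 1, -1` and the minor of `B`) give (P1) `B (ker A) ⊆ im A` and (P2)
  `A y = B x, x ∈ ker A ⟹ B y ∈ im A` for every `B` in the span.  Then either some `B Π` has rank `2`
  — and (P2), polarised, forces every `D i` to have image in `im A`: class `(2,0)` — or the family
  `i ↦ D i Π` is a rank-`≤ 1` pencil, and the dichotomy gives class `(1,2)` (`D i = u vᵢᵀ + (D i Y)(Ψ A)`)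
  or class `(0,3)` (`D i = uᵢ vᵀ + (D i Y)(Ψ A)`).
Consequences for the crux (same file, § 2): `hclR_disp_split_d_le_two` — the coefficientwise Stein
displacements `T a b − Z (T a b) Zᵀ` of a pencil with `rank (T(X) − Z T(X) Zᵀ) ≤ d ≤ 2` split as
`G₀ (H₁ a b)ᵀ + (G₁ a b) H₀ᵀ` with CONSTANT `G₀ : N × p`, `H₀ : N × q`, `2p + q ≤ 2d`; and
`hclR_reduction_d_le_two` — the class inequality of stub `stub_compressionReduction` (every generically
nonsingular corner-hiding pencil of class `(p,q)` has `r ≤ 2p + q`, verbatim) implies the crux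
`HiddenCornerLemmaR` for every displacement rank `d ≤ 2`.  (For `d ≥ 3` the reduction needs the
structure theory of primitive spaces of bounded rank — Atkinson–Lloyd 1981, Atkinson 1983 — which is
not in the tree; this file is the complete `d ≤ 2` instance.)
Sources: folklore linear algebra; the classification behind it is Atkinson–Lloyd (1981) / Atkinson
(1983) (spaces of bounded rank two), but only the weighted consequence above is proved and used here.
-/

set_option linter.dupNamespace false

namespace Summit.MatrixMultiplication.MatrixMultiplication.Theorems

open Matrix

variable {m n : Type*} [Fintype m] [Fintype n]

/-! ## § 1  Rank-`≤ 2` pencils split with `2p + q ≤ 2d` -/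

/-- **The rank-two case.** If all combinations of `D` have rank `≤ 2` and some combination `A` has rank
exactly `2`, then `D` is of class `(2,0)`, `(1,2)` or `(0,3)`; in particular `2p + q ≤ 4`. -/
theorem hclR_rank_two_split_of_rank_two [DecidableEq m] [DecidableEq n] {ι : Type*} [Fintype ι]
    [DecidableEq ι] (D : ι → Matrix m n ℂ) (h : ∀ c : ι → ℂ, (∑ i, c i • D i).rank ≤ 2)
    (c₀ : ι → ℂ) (hA : (∑ i, c₀ i • D i).rank = 2) :
    ∃ (p q : ℕ) (G₀ : Matrix m (Fin p) ℂ) (H₀ : Matrix n (Fin q) ℂ)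
      (H₁ : ι → Matrix n (Fin p) ℂ) (G₁ : ι → Matrix m (Fin q) ℂ),
      2 * p + q ≤ 4 ∧ ∀ i, D i = G₀ * (H₁ i)ᵀ + G₁ i * H₀ᵀ := by
  set A := ∑ i, c₀ i • D i with hAdef
  clear_value A
  obtain ⟨U, Ψ, Y, hΨU, hAY, hUΨA⟩ := hclR_frame_exists A hA
  -- rank bounds for every member `B = Σ c • D` of the span, and for `A ± B`
  have hrk : ∀ c : ι → ℂ, (∑ i, c i • D i).rank ≤ 2 ∧ (A + ∑ i, c i • D i).rank ≤ 2 ∧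
      (A - ∑ i, c i • D i).rank ≤ 2 := by
    intro c
    refine ⟨h c, ?_, ?_⟩
    · have : A + ∑ i, c i • D i = ∑ i, (c₀ + c) i • D i := by
        simp only [hAdef, Pi.add_apply, add_smul, Finset.sum_add_distrib]
      rw [this]
      exact h _
    · have : A - ∑ i, c i • D i = ∑ i, (c₀ - c) i • D i := by
        simp only [hAdef, Pi.sub_apply, sub_smul, Finset.sum_sub_distrib]
      rw [this]
      exact h _
  have hDi : ∀ i, ∑ j, (Pi.single i (1 : ℂ) : ι → ℂ) j • D j = D i := by
    intro i
    simp [Pi.single_apply, ite_smul, Finset.sum_ite_eq']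
  -- the kernel projection and the decomposition `D i = D i P + (D i Y) (Ψ A)`
  set P : Matrix n n ℂ := 1 - Y * (Ψ * A) with hPdef
  clear_value P
  have hdecomp : ∀ i, D i = D i * P + D i * Y * (Ψ * A) := by
    intro i
    rw [hPdef, Matrix.mul_sub, Matrix.mul_one, Matrix.mul_assoc, sub_add_cancel]
  by_cases hcase : ∀ c : ι → ℂ, (∑ i, c i • (D i * P)).rank ≤ 1
  · -- the restrictions to `ker A` form a rank-one pencil: dichotomy
    rcases hclR_rank_le_one_pencil_dichotomy (fun i => D i * P) hcase with ⟨u, hu⟩ | ⟨v, hv⟩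
    · -- column type: class (1, 2)
      choose v hv using hu
      refine ⟨1, 2, Matrix.of fun a _ => u a, (Ψ * A)ᵀ, fun i => Matrix.of fun k _ => v i k,
        fun i => D i * Y, by norm_num, fun i => ?_⟩
      rw [Matrix.transpose_transpose]
      conv_lhs => rw [hdecomp i, hv i]
      congr 1
      ext a k
      simp [Matrix.mul_apply, Matrix.vecMulVec_apply]
    · -- row type: class (0, 3)
      choose u hu using hv
      refine ⟨0, 3, 0, Matrix.of fun k l => ![v k, (Ψ * A) 0 k, (Ψ * A) 1 k] l, fun _ => 0,
        fun i => Matrix.of fun a l => ![u i a, (D i * Y) a 0, (D i * Y) a 1] l, by norm_num,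
        fun i => ?_⟩
      conv_lhs => rw [hdecomp i, hu i]
      ext a k
      simp only [Matrix.add_apply, Matrix.vecMulVec_apply, Matrix.mul_apply, Fin.sum_univ_three,
        Fin.sum_univ_two, Matrix.zero_mul, Matrix.zero_apply, Matrix.of_apply,
        Matrix.transpose_apply, Matrix.cons_val_zero, Matrix.cons_val_one, Matrix.cons_val_two,
        Matrix.head_cons, Matrix.tail_cons, zero_add]
      ring
  · -- some `B P` has rank two: class (2, 0)
    push Not at hcase
    obtain ⟨c₁, hc₁⟩ := hcase
    set B := ∑ i, c₁ i • D i with hBdef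
    clear_value B
    have hBP : ∑ i, c₁ i • (D i * P) = B * P := by
      rw [hBdef, Matrix.sum_mul]
      simp only [Matrix.smul_mul]
    rw [hBP] at hc₁
    obtain ⟨hB, hApB, hAmB⟩ := hrk c₁
    rw [← hBdef] at hB hApB hAmB
    have hP1B := hclR_P1_matrix hΨU hAY hUΨA hB hApB hAmB
    rw [← hPdef] at hP1B
    have hrank2 : 2 ≤ (Ψ * (B * P)).rank := by
      have := Matrix.rank_mul_le_right U (Ψ * (B * P))
      rw [← hP1B] at this
      omega
    obtain ⟨R, hR⟩ := hclR_rightInverse_of_rank (Ψ * (B * P)) hrank2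
    -- `X := P R Ψ A` satisfies `A X = 0` and `B X = A`
    set X := P * (R * (Ψ * A)) with hXdef
    clear_value X
    have hAP : A * P = 0 := by rw [hPdef]; exact hclR_frame_mul_proj hAY hUΨA
    have hAX : A * X = 0 := by
      rw [hXdef, ← Matrix.mul_assoc, hAP, Matrix.zero_mul]
    have hBX : B * X = A := by
      rw [hXdef, ← Matrix.mul_assoc, hP1B, Matrix.mul_assoc U, ← Matrix.mul_assoc (Ψ * (B * P)), hR,
        Matrix.one_mul, hUΨA]
    -- `B` has image in `im A`
    have hBim : (1 - U * Ψ) * B = 0 := by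
      have := hclR_P2_matrix hΨU hAY hUΨA hB hApB hAmB (Xm := X) (Ym := 1) hAX
        (by rw [Matrix.mul_one, hBX])
      rwa [Matrix.mul_one] at this
    -- every `D i` has image in `im A` (polarisation of (P2))
    have hDim : ∀ i, (1 - U * Ψ) * D i = 0 := by
      intro i
      obtain ⟨hD, hApD, hAmD⟩ := hrk (Pi.single i 1)
      rw [hDi i] at hD hApD hAmD
      obtain ⟨hBD, hApBD, hAmBD⟩ := hrk (c₁ + Pi.single i 1)
      have hsum : ∑ j, (c₁ + Pi.single i 1 : ι → ℂ) j • D j = B + D i := by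
        simp only [Pi.add_apply, add_smul, Finset.sum_add_distrib, hDi i, hBdef]
      rw [hsum] at hBD hApBD hAmBD
      -- `D i X = U Ψ (D i X)` by (P1) for `D i`
      have hP1D := hclR_P1_matrix hΨU hAY hUΨA hD hApD hAmD
      rw [← hPdef] at hP1D
      have hDX : D i * X = U * (Ψ * (D i * X)) := by
        have e : D i * X = U * (Ψ * (D i * P)) * (R * (Ψ * A)) := by
          conv_lhs => rw [hXdef, ← Matrix.mul_assoc (D i), hP1D]
        rw [e]
        simp only [Matrix.mul_assoc]
        rw [← Matrix.mul_assoc Ψ U, hΨU, Matrix.one_mul]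
      -- (P2) for `D i` with `Ym = Y Ψ D i X`
      have h2 : (1 - U * Ψ) * (D i * (Y * (Ψ * (D i * X)))) = 0 := by
        refine hclR_P2_matrix hΨU hAY hUΨA hD hApD hAmD hAX ?_
        rw [← Matrix.mul_assoc, hAY, ← hDX]
      -- (P2) for `B + D i` with `Ym = 1 + Y Ψ D i X`
      have h3 : (1 - U * Ψ) * ((B + D i) * (1 + Y * (Ψ * (D i * X)))) = 0 := by
        refine hclR_P2_matrix hΨU hAY hUΨA hBD hApBD hAmBD hAX ?_
        rw [Matrix.mul_add, Matrix.mul_one, ← Matrix.mul_assoc A Y, hAY, ← hDX, Matrix.add_mul, hBX]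
      have e : (1 - U * Ψ) * ((B + D i) * (1 + Y * (Ψ * (D i * X)))) =
          (1 - U * Ψ) * B * (1 + Y * (Ψ * (D i * X))) + (1 - U * Ψ) * D i +
            (1 - U * Ψ) * (D i * (Y * (Ψ * (D i * X)))) := by
        simp only [Matrix.mul_add, Matrix.add_mul, Matrix.mul_one, Matrix.mul_assoc]
        abel
      rw [e, hBim, Matrix.zero_mul, zero_add, h2, add_zero] at h3
      exact h3
    refine ⟨2, 0, U, 0, fun i => (Ψ * D i)ᵀ, fun _ => 0, by norm_num, fun i => ?_⟩
    rw [Matrix.transpose_transpose, Matrix.zero_mul, add_zero]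
    have := hDim i
    rw [Matrix.sub_mul, Matrix.one_mul, sub_eq_zero] at this
    rw [← Matrix.mul_assoc]
    exact this

omit [Fintype m] in
/-- A matrix of rank `0` is zero. -/
theorem hclR_eq_zero_of_rank_eq_zero (M : Matrix m n ℂ) (hM : M.rank = 0) : M = 0 := by
  have hbot : LinearMap.range M.mulVecLin = ⊥ := Submodule.finrank_eq_zero.mp hM
  rw [LinearMap.range_eq_bot] at hbot
  refine Matrix.ext_iff_mulVec.mpr fun v => ?_
  have := LinearMap.congr_fun hbot v
  simpa using this

/-- **Main result.** A family of complex matrices all of whose linear combinations have rank `≤ d`,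
`d ≤ 2`, lies in a `(p,q)`-compression class with `2p + q ≤ 2d`: there are constant
`G₀ : m × p`, `H₀ : n × q` and families `H₁`, `G₁` with `D i = G₀ (H₁ i)ᵀ + (G₁ i) H₀ᵀ`. -/
theorem hclR_rank_le_two_pencil_split [DecidableEq m] [DecidableEq n] {ι : Type*} [Fintype ι]
    [DecidableEq ι] (D : ι → Matrix m n ℂ) (d : ℕ) (hd : d ≤ 2)
    (h : ∀ c : ι → ℂ, (∑ i, c i • D i).rank ≤ d) :
    ∃ (p q : ℕ) (G₀ : Matrix m (Fin p) ℂ) (H₀ : Matrix n (Fin q) ℂ)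
      (H₁ : ι → Matrix n (Fin p) ℂ) (G₁ : ι → Matrix m (Fin q) ℂ),
      2 * p + q ≤ 2 * d ∧ ∀ i, D i = G₀ * (H₁ i)ᵀ + G₁ i * H₀ᵀ := by
  have hDi : ∀ i, ∑ j, (Pi.single i (1 : ℂ) : ι → ℂ) j • D j = D i := by
    intro i
    simp [Pi.single_apply, ite_smul, Finset.sum_ite_eq']
  by_cases h0 : ∀ i, D i = 0
  · exact ⟨0, 0, 0, 0, fun _ => 0, fun _ => 0, by omega, fun i => by simp [h0 i]⟩
  push Not at h0
  obtain ⟨i₀, hi₀⟩ := h0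
  have hd1 : 1 ≤ d := by
    by_contra hlt
    have : (D i₀).rank = 0 := by
      have := h (Pi.single i₀ 1)
      rw [hDi] at this
      omega
    exact hi₀ (hclR_eq_zero_of_rank_eq_zero _ this)
  by_cases h1 : ∀ c : ι → ℂ, (∑ i, c i • D i).rank ≤ 1
  · rcases hclR_rank_le_one_pencil_dichotomy D h1 with ⟨u, hu⟩ | ⟨v, hv⟩
    · choose v hv using hu
      refine ⟨1, 0, Matrix.of fun a _ => u a, 0, fun i => Matrix.of fun k _ => v i k, fun _ => 0,
        by omega, fun i => ?_⟩
      rw [hv i]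
      ext a k
      simp [Matrix.mul_apply, Matrix.vecMulVec_apply]
    · choose u hu using hv
      refine ⟨0, 1, 0, Matrix.of fun k _ => v k, fun _ => 0, fun i => Matrix.of fun a _ => u i a,
        by omega, fun i => ?_⟩
      rw [hu i]
      ext a k
      simp [Matrix.mul_apply, Matrix.vecMulVec_apply]
  · push Not at h1
    obtain ⟨c₀, hc₀⟩ := h1
    have hd2 : d = 2 := by
      have := h c₀
      omega
    subst hd2
    have hA : (∑ i, c₀ i • D i).rank = 2 := le_antisymm (h c₀) hc₀
    exact hclR_rank_two_split_of_rank_two D h c₀ hA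

/-! ## § 2  The compression reduction of the hidden-corner lemma for `d ≤ 2` -/

/-- **The displacement pencil of a corner-hiding pencil with `d ≤ 2` splits cheaply.**  If every
`T(X) − Z T(X) Zᵀ` has rank `≤ d ≤ 2`, then the coefficientwise displacements lie in a
`(p,q)`-compression class with constant outer factors and `2p + q ≤ 2d`:
`∇(T a b) = G₀ (H₁ a b)ᵀ + (G₁ a b) H₀ᵀ`, `G₀ : N × p`, `H₀ : N × q` constant. -/
theorem hclR_disp_split_d_le_two (r N d : ℕ) (T : Fin r → Fin r → Matrix (Fin N) (Fin N) ℂ)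
    (hd : d ≤ 2)
    (hdisp : ∀ X : Matrix (Fin r) (Fin r) ℂ, ((∑ a : Fin r, ∑ b : Fin r, X a b • T a b) -
        (Matrix.of fun i j : Fin N => if (i : ℕ) = (j : ℕ) + 1 then (1 : ℂ) else 0) *
        (∑ a : Fin r, ∑ b : Fin r, X a b • T a b) *
        (Matrix.of fun i j : Fin N => if (i : ℕ) = (j : ℕ) + 1 then (1 : ℂ) else 0)ᵀ).rank ≤ d) :
    ∃ (p q : ℕ) (G₀ : Matrix (Fin N) (Fin p) ℂ) (H₀ : Matrix (Fin N) (Fin q) ℂ)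
      (H₁ : Fin r → Fin r → Matrix (Fin N) (Fin p) ℂ) (G₁ : Fin r → Fin r → Matrix (Fin N) (Fin q) ℂ),
      2 * p + q ≤ 2 * d ∧
      ∀ a b, T a b - (Matrix.of fun i j : Fin N => if (i : ℕ) = (j : ℕ) + 1 then (1 : ℂ) else 0) *
          T a b * (Matrix.of fun i j : Fin N => if (i : ℕ) = (j : ℕ) + 1 then (1 : ℂ) else 0)ᵀ
        = G₀ * (H₁ a b)ᵀ + G₁ a b * H₀ᵀ := by
  set Z := (Matrix.of fun i j : Fin N => if (i : ℕ) = (j : ℕ) + 1 then (1 : ℂ) else 0) with hZ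
  -- the displacement pencil, indexed by pairs
  let D : Fin r × Fin r → Matrix (Fin N) (Fin N) ℂ := fun ab => T ab.1 ab.2 - Z * T ab.1 ab.2 * Zᵀ
  have hlin : ∀ c : Fin r × Fin r → ℂ, (∑ i, c i • D i) =
      (∑ a : Fin r, ∑ b : Fin r, (fun a b => c (a, b)) a b • T a b) -
        Z * (∑ a : Fin r, ∑ b : Fin r, (fun a b => c (a, b)) a b • T a b) * Zᵀ := by
    intro c
    simp only [D, smul_sub, Finset.sum_sub_distrib, Finset.mul_sum, Finset.sum_mul, Matrix.mul_smul,
      Matrix.smul_mul]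
    rw [← Finset.sum_product' (f := fun a b => c (a, b) • T a b),
      ← Finset.sum_product' (f := fun a b => c (a, b) • (Z * T a b * Zᵀ))]
    simp [Finset.univ_product_univ]
  have hrank : ∀ c : Fin r × Fin r → ℂ, (∑ i, c i • D i).rank ≤ d := by
    intro c
    rw [hlin c]
    exact hdisp _
  obtain ⟨p, q, G₀, H₀, H₁, G₁, hpq, hsplit⟩ := hclR_rank_le_two_pencil_split D d hd hrank
  exact ⟨p, q, G₀, H₀, fun a b => H₁ (a, b), fun a b => G₁ (a, b), hpq, fun a b => hsplit (a, b)⟩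

/-- **Compression reduction at displacement rank `d ≤ 2`** (the `d ≤ 2` instance of stub
`stub_compressionReduction` of line `frobenius-dual-short-syzygies`).  If every generically
nonsingular corner-hiding pencil of compression class `(p,q)` satisfies `r ≤ 2p + q` (the class
inequality, verbatim as in the stub), then the hidden-corner lemma `HiddenCornerLemmaR` holds for
all displacement ranks `d ≤ 2`: `r ≤ 2d`.  Proof: `hclR_disp_split_d_le_two` puts the pencil in a class
with `2p + q ≤ 2d`, and the class inequality applies to the pencil itself. -/
theorem hclR_reduction_d_le_two :
    (∀ (r N p q : ℕ) (T : Fin r → Fin r → Matrix (Fin N) (Fin N) ℂ) (E F : Matrix (Fin N) (Fin r) ℂ)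
        (G₀ : Matrix (Fin N) (Fin p) ℂ) (H₀ : Matrix (Fin N) (Fin q) ℂ)
        (H₁ : Fin r → Fin r → Matrix (Fin N) (Fin p) ℂ) (G₁ : Fin r → Fin r → Matrix (Fin N) (Fin q) ℂ),
        E.rank = r → F.rank = r →
        (∀ X : Matrix (Fin r) (Fin r) ℂ, (∑ a : Fin r, ∑ b : Fin r, X a b • T a b) * E = F * X) →
        (∀ a b, T a b - (Matrix.of fun i j : Fin N => if (i : ℕ) = (j : ℕ) + 1 then (1 : ℂ) else 0) * T a b *
            (Matrix.of fun i j : Fin N => if (i : ℕ) = (j : ℕ) + 1 then (1 : ℂ) else 0)ᵀ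
            = G₀ * (H₁ a b)ᵀ + G₁ a b * H₀ᵀ) →
        (∃ X₀ : Matrix (Fin r) (Fin r) ℂ, (∑ a : Fin r, ∑ b : Fin r, X₀ a b • T a b).det ≠ 0) →
        r ≤ 2 * p + q) →
    ∀ (r N d : ℕ) (T : Fin r → Fin r → Matrix (Fin N) (Fin N) ℂ) (E F : Matrix (Fin N) (Fin r) ℂ),
      d ≤ 2 → E.rank = r → F.rank = r →
      (∀ X : Matrix (Fin r) (Fin r) ℂ, (∑ a : Fin r, ∑ b : Fin r, X a b • T a b) * E = F * X) →
      (∀ X : Matrix (Fin r) (Fin r) ℂ, ((∑ a : Fin r, ∑ b : Fin r, X a b • T a b) -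
        (Matrix.of fun i j : Fin N => if (i : ℕ) = (j : ℕ) + 1 then (1 : ℂ) else 0) *
        (∑ a : Fin r, ∑ b : Fin r, X a b • T a b) *
        (Matrix.of fun i j : Fin N => if (i : ℕ) = (j : ℕ) + 1 then (1 : ℂ) else 0)ᵀ).rank ≤ d) →
      (∃ X₀ : Matrix (Fin r) (Fin r) ℂ, (∑ a : Fin r, ∑ b : Fin r, X₀ a b • T a b).det ≠ 0) →
      r ≤ 2 * d := by
  intro hclass r N d T E F hd hE hF hcorner hdisp hns
  obtain ⟨p, q, G₀, H₀, H₁, G₁, hpq, hsplit⟩ := hclR_disp_split_d_le_two r N d T hd hdisp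
  have := hclass r N p q T E F G₀ H₀ H₁ G₁ hE hF hcorner hsplit hns
  omega

end Summit.MatrixMultiplication.MatrixMultiplication.Theorems
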